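import Mathlib
import Summits.Ventures.PercRepro2.Defs
import Summits.Ventures.PercRepro2.Harris
import Summits.Ventures.PercRepro2.CoinDefs
import Summits.Ventures.PercRepro2.CoinInduced
import Summits.Ventures.PercRepro2.CoinLsmCoreDefs
import Summits.Ventures.PercRepro2.CoinLsmCoreU
import Summits.Ventures.PercRepro2.CoinOrTailKDefs
import Summits.Ventures.PercRepro2.CoinTreeCore
import Summits.Ventures.PercRepro2.CoinKSureTailSums
import Summits.Ventures.PercRepro2.CoinSubdivide
import Summits.Ventures.PercRepro2.CoinKSureSubOrTail
import Summits.Ventures.PercRepro2.CoinKSureSubLsm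
import Summits.Ventures.PercRepro2.CoinKSureSubGen
import Summits.Ventures.PercRepro2.CoinKSureMarkerB

/-!
# A marker at a second OR-vertex with ARBITRARY coins (blind cell PercRepro2, night-2 g15;
proofs/NIGHT2-DARC.md §54)

§53's theorem needs sure entry coins for both OR-vertices.  Subdividing the entry coins of `b`
(§52, `darc_sub_iff`) — the OR-tail `a` survives untouched over the extended core
(`orTailK_sub_untouched'`), `b` becomes a sure-entered OR-tail of the extended core
(`orTailK_sub`), and the extended core stays log-supermodular (`subCore_lsm_gen`) — gives
`darc_of_orTailK_markerB_bcoins` (sure `a`-coins, ANY `b`-coins); subdividing the `a`-coins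
first (`orTailK_sub`, `subCore_lsm`) and applying it gives `darc_of_orTailK_markerB_coins`
(ANY coins on both), with the out-tree corollary.
-/

namespace Summit.Ventures.PercRepro2.Coin

open Classical

section Untouched'

variable {V : Type*} {E : Type*} [DecidableEq V] [DecidableEq E]
  {arcs : E → Finset (V × V)} {s : V} {S : Finset E} {src tgt : E → V}

/-- `subCore (insert a U) S₀ = insert (inl a) (subCore U S₀)`. -/
lemma subCore_insert_left (U : Finset V) (S₀ : Finset E) (a : V) :
    subCore (insert a U) S₀ = insert (Sum.inl a) (subCore U S₀) := by
  unfold subCore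
  rw [Finset.map_insert, Finset.insert_union]
  rfl

/-- **An OR-tail survives the subdivision of other coins** (targets may lie in the core). -/
theorem orTailK_sub_untouched' {U₀ ent₀ : Finset V} {c₀ : V → E} {a₀ : V}
    (h₀ : OrTailK arcs s U₀ ent₀ c₀ a₀) (hsrc : ∀ e ∈ S, src e ∈ U₀)
    (htgts : ∀ e ∈ S, tgt e ≠ s) (htgta : ∀ e ∈ S, tgt e ≠ a₀)
    (hc₀ : ∀ r ∈ ent₀, c₀ r ∉ S) :
    OrTailK (subArcs arcs S src tgt) (Sum.inl s) (subCore U₀ S) (ent₀.map Function.Embedding.inl)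
      (Sum.elim (fun v => Sum.inl (c₀ v)) (fun e => Sum.inr e)) (Sum.inl a₀) where
  ent_sub := by
    intro x hx
    obtain ⟨r, hr, rfl⟩ := Finset.mem_map.1 hx
    exact (inl_mem_subCore).2 (h₀.ent_sub hr)
  s_notin := by rw [inl_mem_subCore]; exact h₀.s_notin
  a_notin := by rw [inl_mem_subCore]; exact h₀.a_notin
  a_ne_s := fun e => h₀.a_ne_s (Sum.inl_injective e)
  into_U := by
    intro e' xy hxy hy
    cases e' with
    | inl e₁ =>
      simp only [subArcs] at hxy
      by_cases h₁ : e₁ ∈ S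
      · rw [if_pos h₁, Finset.mem_singleton] at hxy
        rw [hxy]
        exact Or.inl ((inl_mem_subCore).2 (hsrc e₁ h₁))
      · rw [if_neg h₁] at hxy
        obtain ⟨⟨x, y⟩, hxy₀, hf⟩ := Finset.mem_map.1 hxy
        have hf' : (Sum.inl x, Sum.inl y) = xy := hf
        rw [← hf'] at hy ⊢
        have hyU : y ∈ U₀ := (inl_mem_subCore).1 hy
        rcases h₀.into_U e₁ (x, y) hxy₀ hyU with hx | hx
        · exact Or.inl ((inl_mem_subCore).2 hx)
        · exact Or.inr (by rw [show x = s from hx])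
    | inr e₁ =>
      simp only [subArcs] at hxy
      by_cases h₁ : e₁ ∈ S
      · rw [if_pos h₁, Finset.mem_singleton] at hxy
        rw [hxy]
        exact Or.inl ((inr_mem_subCore).2 h₁)
      · rw [if_neg h₁] at hxy
        exact absurd hxy (Finset.notMem_empty _)
  into_s := by
    intro e' xy hxy hy
    cases e' with
    | inl e₁ =>
      simp only [subArcs] at hxy
      by_cases h₁ : e₁ ∈ S
      · rw [if_pos h₁, Finset.mem_singleton] at hxy
        rw [hxy] at hy
        exact absurd hy Sum.inr_ne_inl
      · rw [if_neg h₁] at hxy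
        obtain ⟨⟨x, y⟩, hxy₀, hf⟩ := Finset.mem_map.1 hxy
        have hf' : (Sum.inl x, Sum.inl y) = xy := hf
        rw [← hf'] at hy ⊢
        have hys : y = s := Sum.inl_injective hy
        rcases h₀.into_s e₁ (x, y) hxy₀ hys with hx | hx
        · exact Or.inl ((inl_mem_subCore).2 hx)
        · exact Or.inr (by rw [show x = s from hx])
    | inr e₁ =>
      simp only [subArcs] at hxy
      by_cases h₁ : e₁ ∈ S
      · rw [if_pos h₁, Finset.mem_singleton] at hxy
        rw [hxy] at hy
        exact absurd (Sum.inl_injective hy) (htgts e₁ h₁)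
      · rw [if_neg h₁] at hxy
        exact absurd hxy (Finset.notMem_empty _)
  into_a := by
    intro e' xy hxy hy
    cases e' with
    | inl e₁ =>
      simp only [subArcs] at hxy
      by_cases h₁ : e₁ ∈ S
      · rw [if_pos h₁, Finset.mem_singleton] at hxy
        rw [hxy] at hy
        exact absurd hy Sum.inr_ne_inl
      · rw [if_neg h₁] at hxy
        obtain ⟨⟨x, y⟩, hxy₀, hf⟩ := Finset.mem_map.1 hxy
        have hf' : (Sum.inl x, Sum.inl y) = xy := hf
        rw [← hf'] at hy ⊢
        have hya : y = a₀ := Sum.inl_injective hy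
        obtain ⟨r, hr, he₁, hx⟩ := h₀.into_a e₁ (x, y) hxy₀ hya
        refine ⟨Sum.inl r, Finset.mem_map_of_mem _ hr, ?_, ?_⟩
        · change Sum.inl e₁ = Sum.inl (c₀ r)
          rw [he₁]
        · rw [show x = r from hx]
    | inr e₁ =>
      simp only [subArcs] at hxy
      by_cases h₁ : e₁ ∈ S
      · rw [if_pos h₁, Finset.mem_singleton] at hxy
        rw [hxy] at hy
        exact absurd (Sum.inl_injective hy) (htgta e₁ h₁)
      · rw [if_neg h₁] at hxy
        exact absurd hxy (Finset.notMem_empty _)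
  arcs_c := by
    intro r' hr'
    obtain ⟨r, hr, rfl⟩ := Finset.mem_map.1 hr'
    change subArcs arcs S src tgt (Sum.inl (c₀ r)) = {(Sum.inl r, Sum.inl a₀)}
    simp only [subArcs, if_neg (hc₀ r hr)]
    rw [h₀.arcs_c r hr, Finset.map_singleton]
    rfl
  c_inj := by
    intro r' hr' r'' hr'' heq
    obtain ⟨r, hr, rfl⟩ := Finset.mem_map.1 hr'
    obtain ⟨r₂, hr₂, rfl⟩ := Finset.mem_map.1 hr''
    change (Sum.inl (c₀ r) : E ⊕ E) = Sum.inl (c₀ r₂) at heq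
    change (Sum.inl r : V ⊕ E) = Sum.inl r₂
    rw [h₀.c_inj r hr r₂ hr₂ (Sum.inl_injective heq)]

end Untouched'

section MarkerBCoins

variable {V : Type*} {E : Type*} [Fintype V] [DecidableEq V] [Fintype E] [DecidableEq E]
  {R : Type*} [Field R] [LinearOrder R] [IsStrictOrderedRing R]
  {arcs : E → Finset (V × V)} {s : V} {U : Finset V} {ent : Finset V} {c : V → E} {a w : V}
  {entb : Finset V} {d : V → E} {b : V}

/-- **THEOREM (marker at a second OR-vertex `b`, sure `a`-coins, ARBITRARY `b`-coins).** -/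
theorem darc_of_orTailK_markerB_bcoins (pr : E → R) (hp : IsProbVec pr) (hS : SameEnds arcs)
    (h : OrTailK arcs s U ent c a) (hb : OrTailK arcs s (insert a U) entb d b) (hae : a ∉ entb)
    {m : V} (hm : m ∈ U) (hsure : ∀ r ∈ ent, pr (c r) = 1)
    (hν : ∀ W W', W ⊆ U → W' ⊆ U →
      prob pr (coreLevel arcs s U W) * prob pr (coreLevel arcs s U W') ≤
        prob pr (coreLevel arcs s U (W ∩ W')) * prob pr (coreLevel arcs s U (W ∪ W')))
    {t : V} (htC : t ∉ insert b (insert a U)) (hts : t ≠ s) (hws : w ≠ s)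
    (hwC : w ∉ insert b (insert a U)) :
    DARC pr arcs s {t} m b a w := by
  have hba : b ≠ a := fun e => hb.a_notin (e ▸ Finset.mem_insert_self a U)
  have hbU : b ∉ U := fun hbU => hb.a_notin (Finset.mem_insert_of_mem hbU)
  have hentU : entb ⊆ U := by
    intro r hr
    have := hb.ent_sub hr
    rw [Finset.mem_insert] at this
    rcases this with rfl | h'
    · exact absurd hr hae
    · exact h'
  -- the subdivided coins: the entry coins of `b`
  have hSb := hb.arcs_entry
  have hsrc : ∀ e ∈ entb.image d, srcOf entb d s e ∈ U := fun e he => hentU (hb.srcOf_mem he)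
  have htgt : ∀ e ∈ entb.image d, (fun _ => b) e ∉ U := fun _ _ => hbU
  have htgts : ∀ e ∈ entb.image d, (fun _ => b) e ≠ s := fun _ _ => hb.a_ne_s
  have htgta : ∀ e ∈ entb.image d, (fun _ => b) e ≠ a := fun _ _ => hba
  have hc₀ : ∀ r ∈ ent, c r ∉ entb.image d := by
    intro r hr hmem
    obtain ⟨q, hq, hqr⟩ := Finset.mem_image.1 hmem
    have h1 := h.arcs_c r hr
    have h2 := hb.arcs_c q hq
    rw [hqr] at h2
    rw [h1] at h2
    have : (r, a) ∈ ({(q, b)} : Finset (V × V)) := by rw [← h2]; exact Finset.mem_singleton_self _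
    rw [Finset.mem_singleton, Prod.mk.injEq] at this
    exact hba this.2.symm
  have hU : ClosedInCoreU arcs s U := ⟨h.into_U, h.into_s, h.s_notin⟩
  -- the two OR-tails of the subdivided system
  have h' := orTailK_sub_untouched' (S := entb.image d) (src := srcOf entb d s) (tgt := fun _ => b)
    h hsrc htgts htgta hc₀
  have hb' := orTailK_sub hb
  rw [subCore_insert_left] at hb'
  have hae' : Sum.inl a ∉ (entb.image d).map Function.Embedding.inr := by
    intro hmem
    obtain ⟨e, _, he⟩ := Finset.mem_map.1 hmem
    exact Sum.inr_ne_inl he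
  have hsure' : ∀ r ∈ ent.map Function.Embedding.inl,
      subPr pr ((Sum.elim (fun v => Sum.inl (c v)) (fun e => Sum.inr e) : V ⊕ E → E ⊕ E) r) = 1 := by
    intro r hr
    obtain ⟨r₀, hr₀, rfl⟩ := Finset.mem_map.1 hr
    exact hsure r₀ hr₀
  have hsureb' : ∀ r ∈ (entb.image d).map Function.Embedding.inr,
      subPr pr ((Sum.elim (fun v => Sum.inl (d v)) (fun e => Sum.inr e) : V ⊕ E → E ⊕ E) r) = 1 := by
    intro r hr
    obtain ⟨e, _, rfl⟩ := Finset.mem_map.1 hr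
    rfl
  have hν' := subCore_lsm_gen pr hp hU hSb hsrc htgt htgts hν (entb.image d) (Finset.Subset.refl _)
  simp only [subLawS] at hν'
  have hm' : Sum.inl m ∈ subCore U (entb.image d) := (inl_mem_subCore).2 hm
  have htC' : Sum.inl t ∉ insert (Sum.inl b) (insert (Sum.inl a) (subCore U (entb.image d))) := by
    rw [Finset.mem_insert, Finset.mem_insert, inl_mem_subCore, not_or, not_or]
    rw [Finset.mem_insert, Finset.mem_insert, not_or, not_or] at htC
    exact ⟨fun e => htC.1 (Sum.inl_injective e), fun e => htC.2.1 (Sum.inl_injective e), htC.2.2⟩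
  have hwC' : Sum.inl w ∉ insert (Sum.inl b) (insert (Sum.inl a) (subCore U (entb.image d))) := by
    rw [Finset.mem_insert, Finset.mem_insert, inl_mem_subCore, not_or, not_or]
    rw [Finset.mem_insert, Finset.mem_insert, not_or, not_or] at hwC
    exact ⟨fun e => hwC.1 (Sum.inl_injective e), fun e => hwC.2.1 (Sum.inl_injective e), hwC.2.2⟩
  have key := darc_of_orTailKSure_markerB (subPr pr) (isProbVec_subPr hp) (sameEnds_sub hS) h' hb'
    hae' hm' hsure' hsureb' (fun W W' hW hW' => hν' W hW W' hW') htC'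
    (fun e => hts (Sum.inl_injective e)) (fun e => hws (Sum.inl_injective e)) hwC'
  have hiff := darc_sub_iff hSb pr s {t} m b a w
  rw [Finset.map_singleton] at hiff
  exact hiff.1 key

/-- **THEOREM (marker at a second OR-vertex `b`, ARBITRARY coins on both OR-vertices).**
`OrTailK arcs s U ent c a` and `OrTailK arcs s (insert a U) entb d b` with any entry sets and
any coin probabilities, `a ∉ entb`, `SameEnds`, the cluster law of `U` log-supermodular, the
markers `m ∈ U` and `b`, every head: `DARC pr arcs s {t} m b a w`. -/
theorem darc_of_orTailK_markerB_coins (pr : E → R) (hp : IsProbVec pr) (hS : SameEnds arcs)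
    (h : OrTailK arcs s U ent c a) (hb : OrTailK arcs s (insert a U) entb d b) (hae : a ∉ entb)
    {m : V} (hm : m ∈ U)
    (hν : ∀ W W', W ⊆ U → W' ⊆ U →
      prob pr (coreLevel arcs s U W) * prob pr (coreLevel arcs s U W') ≤
        prob pr (coreLevel arcs s U (W ∩ W')) * prob pr (coreLevel arcs s U (W ∪ W')))
    {t : V} (htC : t ∉ insert b (insert a U)) (hts : t ≠ s) (hws : w ≠ s)
    (hwC : w ∉ insert b (insert a U)) :
    DARC pr arcs s {t} m b a w := by
  have hba : b ≠ a := fun e => hb.a_notin (e ▸ Finset.mem_insert_self a U)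
  -- the subdivided coins: the entry coins of `a`
  have hSa := h.arcs_entry
  have h₁ := orTailK_sub h
  have hsrc₁ : ∀ e ∈ ent.image c, srcOf ent c s e ∈ insert a U :=
    fun e he => Finset.mem_insert_of_mem (h.ent_sub (h.srcOf_mem he))
  have htgts₁ : ∀ e ∈ ent.image c, (fun _ => a) e ≠ s := fun _ _ => h.a_ne_s
  have htgtb : ∀ e ∈ ent.image c, (fun _ => a) e ≠ b := fun _ _ => hba.symm
  have hd₀ : ∀ q ∈ entb, d q ∉ ent.image c := by
    intro q hq hmem
    obtain ⟨r, hr, hrq⟩ := Finset.mem_image.1 hmem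
    have h1 := hb.arcs_c q hq
    have h2 := h.arcs_c r hr
    rw [hrq] at h2
    rw [h1] at h2
    have : (q, b) ∈ ({(r, a)} : Finset (V × V)) := by rw [← h2]; exact Finset.mem_singleton_self _
    rw [Finset.mem_singleton, Prod.mk.injEq] at this
    exact hba this.2
  have hb₁ := orTailK_sub_untouched' (S := ent.image c) (src := srcOf ent c s) (tgt := fun _ => a)
    hb hsrc₁ htgts₁ htgtb hd₀
  rw [subCore_insert_left] at hb₁
  have hae₁ : (Sum.inl a : V ⊕ E) ∉ entb.map (Function.Embedding.inl : V ↪ V ⊕ E) := by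
    intro hmem
    obtain ⟨q, hq, hqa⟩ := Finset.mem_map.1 hmem
    have : q = a := Sum.inl_injective hqa
    exact hae (this ▸ hq)
  have hsure₁ : ∀ r ∈ (ent.image c).map Function.Embedding.inr,
      subPr pr ((Sum.elim (fun v => Sum.inl (c v)) (fun e => Sum.inr e) : V ⊕ E → E ⊕ E) r) = 1 := by
    intro r hr
    obtain ⟨e, _, rfl⟩ := Finset.mem_map.1 hr
    rfl
  have hν₁ := subCore_lsm pr hp h hν (ent.image c) (Finset.Subset.refl _)
  simp only [subLaw] at hν₁
  have hm₁ : Sum.inl m ∈ subCore U (ent.image c) := (inl_mem_subCore).2 hm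
  have htC₁ : Sum.inl t ∉ insert (Sum.inl b) (insert (Sum.inl a) (subCore U (ent.image c))) := by
    rw [Finset.mem_insert, Finset.mem_insert, inl_mem_subCore, not_or, not_or]
    rw [Finset.mem_insert, Finset.mem_insert, not_or, not_or] at htC
    exact ⟨fun e => htC.1 (Sum.inl_injective e), fun e => htC.2.1 (Sum.inl_injective e), htC.2.2⟩
  have hwC₁ : Sum.inl w ∉ insert (Sum.inl b) (insert (Sum.inl a) (subCore U (ent.image c))) := by
    rw [Finset.mem_insert, Finset.mem_insert, inl_mem_subCore, not_or, not_or]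
    rw [Finset.mem_insert, Finset.mem_insert, not_or, not_or] at hwC
    exact ⟨fun e => hwC.1 (Sum.inl_injective e), fun e => hwC.2.1 (Sum.inl_injective e), hwC.2.2⟩
  have key := darc_of_orTailK_markerB_bcoins (subPr pr) (isProbVec_subPr hp) (sameEnds_sub hS)
    h₁ hb₁ hae₁ hm₁ hsure₁ (fun W W' hW hW' => hν₁ W hW W' hW') htC₁
    (fun e => hts (Sum.inl_injective e)) (fun e => hws (Sum.inl_injective e)) hwC₁
  have hiff := darc_sub_iff hSa pr s {t} m b a w
  rw [Finset.map_singleton] at hiff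
  exact hiff.1 key

/-- **The mirror: markers `(b, m)`, arbitrary coins.** -/
theorem darc_of_orTailK_markerB_coins' (pr : E → R) (hp : IsProbVec pr) (hS : SameEnds arcs)
    (h : OrTailK arcs s U ent c a) (hb : OrTailK arcs s (insert a U) entb d b) (hae : a ∉ entb)
    {m : V} (hm : m ∈ U)
    (hν : ∀ W W', W ⊆ U → W' ⊆ U →
      prob pr (coreLevel arcs s U W) * prob pr (coreLevel arcs s U W') ≤
        prob pr (coreLevel arcs s U (W ∩ W')) * prob pr (coreLevel arcs s U (W ∪ W')))
    {t : V} (htC : t ∉ insert b (insert a U)) (hts : t ≠ s) (hws : w ≠ s)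
    (hwC : w ∉ insert b (insert a U)) :
    DARC pr arcs s {t} b m a w :=
  (darc_swap pr arcs s {t} m b a w).1
    (darc_of_orTailK_markerB_coins pr hp hS h hb hae hm hν htC hts hws hwC)

/-- **COROLLARY (out-tree core): a marker at a second OR-vertex, arbitrary coins.** -/
theorem darc_of_orTailTreeK_markerB_coins (pr : E → R) (hp : IsProbVec pr) (hS : SameEnds arcs)
    (h : OrTailK arcs s U ent c a) (hb : OrTailK arcs s (insert a U) entb d b) (hae : a ∉ entb)
    {c' : V → E} {par : V → V} {rk : V → ℕ} (hT : TreeCore arcs s U c' par rk)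
    {m : V} (hm : m ∈ U)
    {t : V} (htC : t ∉ insert b (insert a U)) (hts : t ≠ s) (hws : w ≠ s)
    (hwC : w ∉ insert b (insert a U)) :
    DARC pr arcs s {t} m b a w :=
  darc_of_orTailK_markerB_coins pr hp hS h hb hae hm (hT.coreLevel_lsm pr hp) htC hts hws hwC

end MarkerBCoins

end Summit.Ventures.PercRepro2.Coin
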